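import Summits.Schanuel.Schanuel.Theses.RoyCriterion
import Literature.NumberTheory.Transcendental.RoySmallValueMainLevel
import Literature.NumberTheory.Transcendental.RoySmallValueStep1
import Summits.Schanuel.Schanuel.Theorems.RoySmallValueDirichletGap.Negative.GapReduction
import Summits.Schanuel.Schanuel.Theorems.RoySmallValueDirichletGap.Negative.EtaNeZeroFalse
import Summits.Schanuel.Schanuel.Theorems.RoySmallValueDirichletGap.Negative.TauLtOneAndCountLeDegreeFalse
import Summits.Schanuel.Schanuel.Theorems.RoySmallValueDirichletGap.Negative.FrequentlyFalse

/-!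
# Line `total-closeness-ledger` for crux `RoySmallValueDirichletGap` (item stmt-Schanuel-1050) — crux-plan verdict: NO CONCLUDING SKELETON

Crux (route `RoyCriterion`): `Summit.Schanuel.Schanuel.Theses.RoyCriterion.RoySmallValueDirichletGap`
= Roy 2013 (arXiv:1301.0663) Thm 1.1 with `ν` pushed down to the Dirichlet edge `2 + β − τ`
(open content: `1 < τ < 2`, `0 < δ := ν − (2+β−τ) ≤ δ_R := (τ−1)(2−τ)/(β+1−τ)`).

Idea `total-closeness-ledger` (crux-ideate r2, ideator 4; TRIAGE-r2-1/2/3: pass): do NOT select one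
Galois orbit in Roy's Step 2 — keep the whole intersection cycle `W_D = div P̃_D · div Q_D`
(`deg W_D = D²`); Prop 2.3 is two-sided and Prop 4.5 bounds the distance tests from BELOW, so far
zeros contribute `≥ 0` and the near zeros carry, with multiplicity, ALL of `T·U` (conservation law),
`D^τ/deg Z` times what Roy certifies for the selected orbit.

## What this file certifies (lean check rc 0, NO `sorry`; every theorem kernel-checked, S1 enters as a hypothesis where used)

* §1 **S1 `CycleLedger`, typed over the tree's cycle data** (`Roy2013.LevelPkg`: points `α_i`,
  intersection multiplicities `e_i`, `∑ e_i = D²`, `F = c ∏ ℓ_{α_i}^{e_i}`; TRIAGE-r2-2's demand that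
  the ledger be stated ON THE CYCLE, not as a bare `∃ (n, α, e)`), in the CAPPED form that TRIAGE-r2-1
  (sharpen 2) asks for: `∑_{near i} e_i · max{closeness_i, −(U+Y+D log 2c₂)} ≤ log ε₀ − Y D² + Γ'' D²`
  with the tree's literal constants (`stepTwoEps` = rhs of `LevelPkg.step2_family_le`, `gammaErr` =
  the `Γ''` of `LevelPkg.step2_level`, `≤ D^β` eventually by `Roy2013.eventually_gamma_le_rpow`).
  Provable now (size M): `step2_family_normalised_le` + the test forms of `exists_testForm_max` /
  the cap test `e^{−U}X₀^D` at every point + the bookkeeping of `ZeroConfigK.step2_distance_sum`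
  with `orb i₀ ↦ univ`, unit weights `↦ e_i` — i.e. `step2_core` WITHOUT `exists_component_forall_prod_le`.
* §2 **What S1 forces.** `nearMultiplicity_floor_of_ledger` (PROVED from S1): the near points of the
  cycle have total multiplicity `≥ (Y D² − Γ''D² − log ε₀)/(U + Y + D log 2c₂) = (1−o(1))·T U/(2U)`
  in Roy's normalisation. Typed proposals (NOT registered, NOT composed here): `OrbitMassCap` (Roy's
  Steps 3–5 per vanishing orbit: near mass `≤ C D^{2+β−τ}`; size L, re-exposes `(O, D*)`) and the
  line's honest deliverable `ForcedOverOsculation`: vanishing near orbits carry multiplicity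
  `≥ c D^{τ+δ}`, i.e. the mass-carrying orbit has `e_Z/T ≳ D^{δ(1+β−τ)/(τ−1)} → ∞`
  (`overOsculation_exponent(_pos)`), a statement Roy's selected-orbit certificate does not give.
* §3 **Why no stub closes the residual (O)** — the balance identities, kernel-checked:
  `ledger_bezout_is_roy` (multiplicity gain × Bézout returns Roy's degree exponent `e(δ)` exactly;
  `degExp_royGap`: `e(δ_R) = 0`), `osculationHeight_balanced` (the natural arithmetic cap — an
  osculation–height inequality `log‖P‖ ≳ (m/D)·h(Z)`, consistent with Gelfond, Hermite–Padé and the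
  Thue–Siegel witness — returns Roy's descent bound `D* ≤ C D^{1−δ/(τ−1)}` identically, `h(Z)`
  cancelling), `chainNW_kill_iff`/`chainNW_dead_at_edge` (closing the hand-over between consecutive
  over-osculated servers by a bilinear Hermite–Lindemann measure needs `β < 2τ−2+δ`, i.e. `τ > 2−δ`:
  dead at the edge, = round-1's edge budget), `window_witness_exponents` (the `∃ᶠ` witness of the
  landed `roySmallValueDirichletGap_false_with_frequently` serves whole windows `[D₀^{2ν/(ν+4)}, D₀^{8/(ν+4)}]`
  around each centre, so every LEVEL-LOCAL structure — absorption, rigidity, the ledger itself,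
  over-osculation `m ≈ D²/4 ≫ 3⌊D^τ⌋` at a rational point of height `≲ D^{β−1}` — is realised at a
  transcendental point: no level-local cap on osculation order / intersection multiplicity can be
  both true and sufficient; a sufficient cap must see the data-dependent level `D*` of unbounded ratio,
  and then it quantifies over the whole tower = the crux restricted to a class containing every
  counterexample (costume, TRIAGE-r2-1/2: "crux + the free lemma e ≫ T").
* §4 Read-back against the landed Negative lemmas honoured (`crux_iff_nearEdge`,
  `frequently_variant_false`, `etaNeZero_loadBearing`; count `> D` via `D ≤ T` in S1).

NOT registered with `ledger skeleton check` on purpose: nothing here concludes the crux, and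
registering `stub_*` on the crux item would constrain `propose --supports stmt-Schanuel-1050` for every
other seat. If a planner files `CycleLedger` / `ForcedOverOsculation` as SUPPORT items of route
`RoyCriterion` (recommended in the line card), §1–§2 are their ready signatures.
-/

set_option linter.dupNamespace false

noncomputable section

namespace Summit.Schanuel.Schanuel.Cruxes.RoySmallValueDirichletGap.TotalClosenessLedger

open MvPolynomial Finset Filter Complex
open Literature.NumberTheory.Transcendental
open Literature.NumberTheory.Transcendental.Roy2013
open Summit.Schanuel.Schanuel.Theses.RoyCriterion (RoySmallValueDirichletGap)

/-! ## §0 The crux read back -/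

/-- The small-value hypothesis of the crux at `(ξ, η)` with exponents `(β, τ, ν)` (verbatim
sub-formula of `RoySmallValueDirichletGap`; = `Disproof.SmallValueHyp`). [cite: Roy2013, Theorem 1.1] -/
def SmallValueHyp (ξ η : ℂ) (β τ ν : ℝ) : Prop :=
  ∀ᶠ D : ℕ in atTop, ∃ P : MvPolynomial (Fin 2) ℤ, P ≠ 0 ∧ P.totalDegree ≤ D ∧
    (mvPolyHeight P : ℝ) ≤ Real.exp ((D : ℝ) ^ β) ∧
    ∀ i : ℕ, i < 3 * ⌊(D : ℝ) ^ τ⌋₊ →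
      ‖MvPolynomial.aeval ![ξ, η] (royD^[i] P)‖ ≤ Real.exp (-(D : ℝ) ^ ν)

/-- READ-BACK: the crux verbatim in terms of `SmallValueHyp`. -/
theorem crux_iff : RoySmallValueDirichletGap ↔
    ∀ (ξ η : ℂ), η ≠ 0 → ∀ (β τ ν : ℝ), 1 ≤ τ → τ < 2 → τ < β → 2 + β - τ < ν →
      SmallValueHyp ξ η β τ ν → IsAlgebraic ℚ ξ ∧ IsAlgebraic ℚ η := Iff.rfl

/-! ## §1 The lever: the total-closeness ledger on the intersection cycle (capped form) -/

/-- Roy's Step-2 smallness constant `ε₀ = 2^{2k2^k} · e^{−TU} · N! (3e^Y)^N`, `N = #PhiRow D =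
binom(3D+2, 2)` — the right-hand side of the tree's `LevelPkg.step2_family_le`.
[cite: Roy2013, Propositions 6.1, 2.3–2.4 and §7, Step 2] -/
def stepTwoEps (D T k : ℕ) (Y U : ℝ) : ℝ :=
  2 ^ (2 * k * 2 ^ k) * (Real.exp (-(T * U)) *
    ((Fintype.card (PhiRow D)).factorial * (3 * Real.exp Y) ^ Fintype.card (PhiRow D)))

/-- The interpolation/entropy constant `Γ₀ = log((2^T (3·c_I·c₂')^T (16T³)^T)^{kr})` of the
distance tests (verbatim from the tree's `ZeroConfigK.step2_distance_sum`). [cite: Roy2013, §7, Step 2] -/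
def gammaZero (ξ η : ℂ) (T kr : ℕ) : ℝ :=
  Real.log (2 ^ T * (3 * (3 * (1 + ‖ξ‖ + ‖η‖⁻¹) * max 1 (max ‖ξ‖ ‖η‖)) ^ T *
    (16 * (T : ℝ) ^ 3) ^ T) ^ kr)

/-- The per-point error at NEAR points (verbatim from `ZeroConfigK.step2_distance_sum`).
[cite: Roy2013, §7, Step 2 and Proposition 4.5] -/
def gammaNear (ξ η : ℂ) (T kr : ℕ) : ℝ :=
  max (gammaZero ξ η T kr)
      (Real.log (2 * ((2 * roy_c2 ξ η) ^ T * (1 + roy_c2 ξ η * Real.exp (1 + roy_c2 ξ η)) *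
        (3 * (3 * (1 + ‖ξ‖ + ‖η‖⁻¹) * max 1 (max ‖ξ‖ ‖η‖)) ^ T *
          (16 * (T : ℝ) ^ 3) ^ T) ^ kr))) +
    |Real.log (2 * (roy_c2 ξ η * Real.exp (roy_c2 ξ η) * (2 * roy_c2 ξ η ^ 2) ^ T))|

/-- The per-point error at FAR points (verbatim from `ZeroConfigK.step2_distance_sum`).
[cite: Roy2013, §7, Step 2] -/
def gammaFar (ξ η : ℂ) (T kr : ℕ) : ℝ :=
  gammaZero ξ η T kr - T * Real.log ((2 * roy_c2 ξ η)⁻¹)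

/-- The per-point error `Γ''` covering near and far points (the constant multiplying `#O` in the
tree's `LevelPkg.step2_level`). [cite: Roy2013, §7, Step 2] -/
def gammaErr (ξ η : ℂ) (T kr : ℕ) : ℝ :=
  max (gammaNear ξ η T kr) (gammaFar ξ η T kr)

/-- Roy's signed closeness of a (sup-normalised) point `u` to `(1:γ)` and to the leaf `A_γ`:
`max{T log dist(u,(1:γ)), log dist(u, A_γ)}` with the tree's convention when `dist(u, A_γ) = 0`.
[cite: Roy2013, §7, Step 2] -/
def closeness (ξ η : ℂ) (T : ℕ) (u : Fin 3 → ℂ) : ℝ :=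
  max (T * Real.log (pdist ξ η u))
    (if 0 < adist ξ η u then Real.log (adist ξ η u) else T * Real.log (pdist ξ η u))

/-- **S1 — THE TOTAL-CLOSENESS LEDGER ON THE CYCLE (capped form).** For a level package `L` of an
integer form `P̃` of degree `D` (the tree's `LevelPkg`: the 0-cycle `div P̃ · div Q`, `Q = ∑ tⁱ𝒟ⁱP̃`,
points `α_i`, intersection multiplicities `e_i`, `∑ e_i = D²`) with `P̃, Q ∈ 𝒞 = royBody D ξ η Y U T`,
the NEAR points (`dist(u_i,(1:γ)) ≤ (2c₂)⁻¹`) carry, WITH MULTIPLICITY and CAPPED at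
`U + Y + D log(2c₂)` per point, all the smallness:
`∑_{near i} e_i · max{closeness_i, −(U + Y + D log 2c₂)} ≤ log ε₀ − Y·D² + Γ''·D²`
(`log ε₀ = −TU + N(Y + log 3) + log N! + 2k2^k log 2`), i.e. `≤ −(1 − o(1))·TU` in Roy's regime.
No orbit is selected (contrast `step2_level`, whose certificate for ONE orbit is divided by `B`).
Proof route (size M, all in tree): `LevelPkg.step2_family_normalised_le` (product inequality over
ALL points, exponents `e_i`; drop the favourable height gain) with, at each near point, the better
of the distance test of `exists_testForm_max` (`log|t(u)| ≥ Y + closeness − Γ''`) and the cap test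
`e^{−U}X₀^D ∈ 𝒞` (`|u₀| ≥ (2c₂)⁻¹` by `lemma_4_1`), and the far test at far points; then the
bookkeeping of `ZeroConfigK.step2_distance_sum` with `orb i₀ ↦ univ`, unit weights `↦ e_i`.
[cite: Roy2013, Propositions 2.3, 4.5, 6.1 and §7, Step 2] -/
def CycleLedger : Prop :=
  ∀ (D : ℕ) (Pt : MvPolynomial (Fin 3) ℤ) (L : LevelPkg D Pt),
    (map (Int.castRingHom ℂ) Pt).IsHomogeneous D → map (Int.castRingHom ℂ) Pt ≠ 0 →
  ∀ (ξ η : ℂ), η ≠ 0 → ¬ (IsAlgebraic ℚ ξ ∧ IsAlgebraic ℚ η) →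
  ∀ (T Li kr k : ℕ), (Li + 1).choose 2 < T → T ≤ (Li + 2).choose 2 → 3 * (Li + 1) ≤ D → D ≤ T →
    2 ^ kr * T ≤ 3 ^ kr * D → D ^ 2 ≤ 2 ^ k →
  ∀ (Y U : ℝ), 0 < Y → 0 ≤ U →
    (3 * (1 + ‖ξ‖ + ‖η‖⁻¹)) ^ Li * (4 * (Li + 1) : ℝ) ^ (Li + 2).choose 2 ≤ Real.exp Y →
    map (Int.castRingHom ℂ) Pt ∈ royBody D ξ η Y U T →
    map (Int.castRingHom ℂ) (levelQ D Pt L.t) ∈ royBody D ξ η Y U T →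
    ∑ i ∈ (univ : Finset (Fin L.m)).filter
        (fun i => pdist ξ η (supNormalise (L.α i)) ≤ (2 * roy_c2 ξ η)⁻¹),
        (L.e i : ℝ) * max (closeness ξ η T (supNormalise (L.α i)))
          (-(U + Y + D * Real.log (2 * roy_c2 ξ η))) ≤
      Real.log (stepTwoEps D T k Y U) - Y * (D : ℝ) ^ 2 + gammaErr ξ η T kr * (D : ℝ) ^ 2

/-- `Γ''` is the tree's literal Step-2 error constant: for large `n` it is `≤ n^β`
(`1 ≤ T ≤ n^τ`, `kr ≤ 1 + 3 log n`) — read-back against `Roy2013.eventually_gamma_le_rpow`. -/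
theorem eventually_gammaErr_le_rpow (ξ η : ℂ) {τ β : ℝ} (hτ0 : 0 < τ) (hτβ : τ < β) :
    ∀ᶠ n : ℕ in atTop, ∀ T kr : ℕ, 1 ≤ T → (T : ℝ) ≤ (n : ℝ) ^ τ → (kr : ℝ) ≤ 1 + 3 * Real.log n →
      gammaErr ξ η T kr ≤ (n : ℝ) ^ β :=
  eventually_gamma_le_rpow ξ η hτ0 hτβ

/-! ## §2 What the ledger forces: multiplicity near `γ` (level-local floor, PROVED from S1) and
over-osculation of the mass-carrying orbit (typed; needs Roy's Step 4) -/

/-- **S1 ⇒ near-multiplicity floor (level-local, kernel-checked from `CycleLedger`).** Since every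
capped term is `≥ −e_i (U + Y + D log 2c₂)`, the ledger forces
`∑_{near i} e_i ≥ (Y D² − Γ'' D² − log ε₀)/(U + Y + D log 2c₂)`; in Roy's normalisation
(`T = ⌊D^τ⌋`, `Y = 3D^β`, `U = D^ν/4`, `log ε₀ + Y D² ≤ −TU/2` by `Roy2013.eventually_log_eps`,
`Γ'' ≤ D^β` by `eventually_gammaErr_le_rpow`) the right-hand side is `(1 − o(1))·TU/(2U) ≥ T/4`:
at least `≍ D^τ` points of the cycle `div P̃_D · div Q_D`, counted with intersection multiplicity,
lie within `(2c₂)⁻¹` of `(1:γ)`. (The per-point cap is what makes the ledger informative: without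
it one abnormally leaf-close algebraic point could carry the whole uncapped sum.) [folklore] -/
theorem nearMultiplicity_floor_of_ledger (hL : CycleLedger) {D : ℕ} {Pt : MvPolynomial (Fin 3) ℤ}
    (L : LevelPkg D Pt) (hPt : (map (Int.castRingHom ℂ) Pt).IsHomogeneous D)
    (hPt0 : map (Int.castRingHom ℂ) Pt ≠ 0) {ξ η : ℂ} (hη : η ≠ 0)
    (hna : ¬ (IsAlgebraic ℚ ξ ∧ IsAlgebraic ℚ η)) {T Li kr k : ℕ} (hT₁ : (Li + 1).choose 2 < T)
    (hT₂ : T ≤ (Li + 2).choose 2) (h3L : 3 * (Li + 1) ≤ D) (hDT : D ≤ T)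
    (hkr : 2 ^ kr * T ≤ 3 ^ kr * D) (hk : D ^ 2 ≤ 2 ^ k) {Y U : ℝ} (hY0 : 0 < Y) (hU : 0 ≤ U)
    (hYI : (3 * (1 + ‖ξ‖ + ‖η‖⁻¹)) ^ Li * (4 * (Li + 1) : ℝ) ^ (Li + 2).choose 2 ≤ Real.exp Y)
    (hPmem : map (Int.castRingHom ℂ) Pt ∈ royBody D ξ η Y U T)
    (hQmem : map (Int.castRingHom ℂ) (levelQ D Pt L.t) ∈ royBody D ξ η Y U T) :
    (Y * (D : ℝ) ^ 2 - gammaErr ξ η T kr * (D : ℝ) ^ 2 - Real.log (stepTwoEps D T k Y U)) /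
        (U + Y + D * Real.log (2 * roy_c2 ξ η)) ≤
      ∑ i ∈ (univ : Finset (Fin L.m)).filter
        (fun i => pdist ξ η (supNormalise (L.α i)) ≤ (2 * roy_c2 ξ η)⁻¹), (L.e i : ℝ) := by
  have hlog : 0 < Real.log (2 * roy_c2 ξ η) := Real.log_pos (by linarith [one_le_roy_c2 ξ η])
  have hC : 0 < U + Y + D * Real.log (2 * roy_c2 ξ η) := by
    have : 0 ≤ (D : ℝ) * Real.log (2 * roy_c2 ξ η) := mul_nonneg (Nat.cast_nonneg _) hlog.le
    linarith
  have hled := hL D Pt L hPt hPt0 ξ η hη hna T Li kr k hT₁ hT₂ h3L hDT hkr hk Y U hY0 hU hYI hPmem hQmem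
  have hlow : ∑ i ∈ (univ : Finset (Fin L.m)).filter
        (fun i => pdist ξ η (supNormalise (L.α i)) ≤ (2 * roy_c2 ξ η)⁻¹),
        (L.e i : ℝ) * (-(U + Y + D * Real.log (2 * roy_c2 ξ η))) ≤
      ∑ i ∈ (univ : Finset (Fin L.m)).filter
        (fun i => pdist ξ η (supNormalise (L.α i)) ≤ (2 * roy_c2 ξ η)⁻¹),
        (L.e i : ℝ) * max (closeness ξ η T (supNormalise (L.α i)))
          (-(U + Y + D * Real.log (2 * roy_c2 ξ η))) :=
    Finset.sum_le_sum fun i _ => mul_le_mul_of_nonneg_left (le_max_right _ _) (Nat.cast_nonneg _)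
  rw [← Finset.sum_mul] at hlow
  rw [div_le_iff₀ hC]
  have hmul : (∑ i ∈ (univ : Finset (Fin L.m)).filter
        (fun i => pdist ξ η (supNormalise (L.α i)) ≤ (2 * roy_c2 ξ η)⁻¹), (L.e i : ℝ)) *
        (-(U + Y + D * Real.log (2 * roy_c2 ξ η))) =
      -((∑ i ∈ (univ : Finset (Fin L.m)).filter
        (fun i => pdist ξ η (supNormalise (L.α i)) ≤ (2 * roy_c2 ξ η)⁻¹), (L.e i : ℝ)) *
        (U + Y + D * Real.log (2 * roy_c2 ξ η))) := by ring
  rw [hmul] at hlow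
  linarith

/-- `∀ j ∈ O`, every INTEGER form of the body `𝒞 = royBody D ξ η Y U T` vanishes at `α_j` — the
conclusion (1) of the tree's `LevelPkg.step2_level` for the selected orbit; here as a predicate on an
arbitrary Galois orbit `O = (L.cfg K hK).orb j₀` of the cycle ("`h_𝒞(Z) < 0`", Roy Prop. 2.3 (2.2)).
[cite: Roy2013, Proposition 2.3 and §7, Step 2] -/
def OrbVanishes {D : ℕ} {Pt : MvPolynomial (Fin 3) ℤ} (L : LevelPkg D Pt)
    (K : IntermediateField ℚ ℂ) (hK : ∀ i k, L.α i k ∈ K) [Normal ℚ K] [NumberField K]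
    (j₀ : Fin L.m) (ξ η : ℂ) (Y U : ℝ) (T : ℕ) : Prop :=
  ∀ R : MvPolynomial (Fin 3) ℤ, R.IsHomogeneous D → map (Int.castRingHom ℂ) R ∈ royBody D ξ η Y U T →
    ∀ j ∈ (L.cfg K hK).orb j₀, aeval (L.α j) (map (Int.castRingHom ℂ) R) = 0

/-- The crux hypothesis in sequence form (`P D` is Roy's `P_D`; = `SketchIdeator4.SmallValueSeq`). -/
def SmallValueSeq (P : ℕ → MvPolynomial (Fin 2) ℤ) (ξ η : ℂ) (β τ ν : ℝ) : Prop :=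
  ∀ᶠ D : ℕ in atTop, P D ≠ 0 ∧ (P D).totalDegree ≤ D ∧
    (mvPolyHeight (P D) : ℝ) ≤ Real.exp ((D : ℝ) ^ β) ∧
    ∀ i : ℕ, i < 3 * ⌊(D : ℝ) ^ τ⌋₊ → ‖aeval ![ξ, η] (royD^[i] (P D))‖ ≤ Real.exp (-(D : ℝ) ^ ν)

/-- **S-C — ORBIT MASS CAP (Roy's Steps 3–4–5, per orbit; TYPED PROPOSAL for a support item, not
registered here).** In a counterexample at `ν = 2+β−τ+δ`, for all large `D` and EVERY Galois orbit `O`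
of the cycle of `P̃_D` on which the integer body forms vanish, the orbit's near CAPPED closeness
mass is `≤ C·D^{2+β−τ}`: `−C D^{2+β−τ} ≤ ∑_{j ∈ O near} max{closeness_j, −(U + Y + D log 2c₂)}`
(tree normalisation `T = ⌊D^τ⌋`, `Y = 3D^β`, `U = D^ν/4`; the same cap as in S1 — Step 4 controls
only capped closeness: a point of a vanishing orbit may sit arbitrarily close to `γ`). Why plausibly
true: `D*(O)` := the last level whose `𝒟ⁱP̃_{D*}` do not all vanish on `O` exists (separation at the
base level); Step 4 (`ZeroConfigK.step45_combined`: `prop_4_2` + `orbit_liouville_K`) gives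
`∑_{O near} max{closeness*_j, −cap*} ≥ −(8(D*)^β deg O + D* h(O) + O(D* deg O))`, Step 3
(`step3_bounds` at `D*+1`) `deg O ≤ 2(D*)^{2−τ}`, `h(O) ≤ 7(D*)^{1+β−τ}`, and
`max{closeness_T, −cap_D} ≥ (T/T*)·max{closeness_{T*}, −cap*}` with
`(D/D*)^τ (D*)^{2+β−2τ} ≤ D^{2+β−τ}` (both signs of `2+β−2τ`). Size L: re-exposes `(O, D*)` now
internal to `RoySmallValueMain`'s `by_contra` (the refactor every r1/r2 card flags).
[cite: Roy2013, §7, Steps 3–5] -/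
def OrbitMassCap : Prop :=
  ∀ (ξ η : ℂ), η ≠ 0 → ¬ (IsAlgebraic ℚ ξ ∧ IsAlgebraic ℚ η) →
  ∀ (β τ δ : ℝ), 1 < τ → τ < 2 → τ < β → 0 < δ →
  ∀ (P : ℕ → MvPolynomial (Fin 2) ℤ), SmallValueSeq P ξ η β τ (2 + β - τ + δ) →
    ∃ C : ℝ, 0 < C ∧ ∀ᶠ D : ℕ in atTop, ∀ (hP0 : P D ≠ 0) (L : LevelPkg D (royTilde D hP0))
      (K : IntermediateField ℚ ℂ) (hK : ∀ i k, L.α i k ∈ K) [Normal ℚ K] [NumberField K]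
      (j₀ : Fin L.m),
      OrbVanishes L K hK j₀ ξ η (3 * (D : ℝ) ^ β) ((D : ℝ) ^ (2 + β - τ + δ) / 4) ⌊(D : ℝ) ^ τ⌋₊ →
      -(C * (D : ℝ) ^ (2 + β - τ)) ≤
        ∑ j ∈ ((L.cfg K hK).orb j₀).filter
          (fun j => pdist ξ η (supNormalise (L.α j)) ≤ (2 * roy_c2 ξ η)⁻¹),
          max (closeness ξ η ⌊(D : ℝ) ^ τ⌋₊ (supNormalise (L.α j)))
            (-((D : ℝ) ^ (2 + β - τ + δ) / 4 + 3 * (D : ℝ) ^ β + D * Real.log (2 * roy_c2 ξ η)))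

open scoped Classical in
/-- **The structure statement the line can deliver: FORCED OVER-OSCULATION (TYPED PROPOSAL for a
support item).** In a counterexample at `ν = 2+β−τ+δ`, for all large `D`, the near points of the cycle
`div P̃_D · div Q_D` lying on VANISHING orbits have total intersection multiplicity
`≥ c·D^{τ+δ}` — `D^δ` (and `(D/D*)^{2+β−2τ}`) times the `≈ 3⌊D^τ⌋` that Roy's absorption gives —
whence (e constant on orbits, `deg·e ≤ D²`) the mass-carrying orbit has `e_Z/T → ∞` and degree
`≪ D^{e(δ)}` (§3: this is exactly Roy's exponent again). Informal composition (NOT kernel-checked here;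
bookkeeping through orbits + the tree's `eventually_*` asymptotics): S1 `CycleLedger` (capped total
`≥ (1−o(1))TU = D^{τ+ν}/8`) − non-vanishing orbits (each carries at most its Liouville share by
`orbit_liouville_K` + `prop_4_2`; in total `≤ D·h(W_D) + D²(Y + D log c₄) = o(TU)` by
`sum_mul_hgtK_le_log_l1Norm`) ⇒ vanishing near orbits carry `(1−o(1))TU`; S-C caps each at
`C D^{2+β−τ}` per unit multiplicity ⇒ `∑ e ≥ (1−o(1)) D^{τ+ν}/(8C D^{2+β−τ}) = c D^{τ+δ}`.
[cite: Roy2013, §7, Steps 2–5] -/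
def ForcedOverOsculation : Prop :=
  ∀ (ξ η : ℂ), η ≠ 0 → ¬ (IsAlgebraic ℚ ξ ∧ IsAlgebraic ℚ η) →
  ∀ (β τ δ : ℝ), 1 < τ → τ < 2 → τ < β → 0 < δ →
  ∀ (P : ℕ → MvPolynomial (Fin 2) ℤ), SmallValueSeq P ξ η β τ (2 + β - τ + δ) →
    ∃ c : ℝ, 0 < c ∧ ∀ᶠ D : ℕ in atTop, ∀ (hP0 : P D ≠ 0) (L : LevelPkg D (royTilde D hP0))
      (K : IntermediateField ℚ ℂ) (hK : ∀ i k, L.α i k ∈ K) [Normal ℚ K] [NumberField K],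
      c * (D : ℝ) ^ (τ + δ) ≤
        ∑ i ∈ (univ : Finset (Fin L.m)).filter
          (fun i => pdist ξ η (supNormalise (L.α i)) ≤ (2 * roy_c2 ξ η)⁻¹ ∧
            OrbVanishes L K hK i ξ η (3 * (D : ℝ) ^ β) ((D : ℝ) ^ (2 + β - τ + δ) / 4) ⌊(D : ℝ) ^ τ⌋₊),
          (L.e i : ℝ)

/-! ## §3 Why (O) cannot be closed by a level-local cap: the balance identities (kernel-checked) -/

/-- Roy's printed correction term `δ_R = (τ−1)(2−τ)/(β+1−τ)` (width of the open window).
[cite: Roy2013, Theorem 1.1, (1.1)] -/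
def royGap (β τ : ℝ) : ℝ := (τ - 1) * (2 - τ) / (β + 1 - τ)

/-- **Over-osculation exponent.** With `D* = D^x` at Roy's extreme `x = b(δ) = 1 − δ/(τ−1)`
(tree `Roy2013.endgame_step`), the ledger's multiplicity gain `D^δ (D/D*)^{2+β−2τ}` over `T` has
exponent `δ + (δ/(τ−1))(2+β−2τ) = δ(1+β−τ)/(τ−1)` (TRIAGE-r2-1 (Q3), r2-2 sharpen (2)). [folklore] -/
theorem overOsculation_exponent {β τ δ : ℝ} (h1 : 1 < τ) :
    δ + δ / (τ - 1) * (2 + β - 2 * τ) = δ * (1 + β - τ) / (τ - 1) := by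
  have hτ : τ - 1 ≠ 0 := by intro h; linarith
  field_simp
  ring

/-- … and it is positive on the whole open range (`1 < τ < β`), for every `δ > 0`: the mass-carrying
orbit is over-osculated by a POWER of `D` — the one level-by-level output of the ledger that Roy's
selected-orbit certificate does not have. [folklore] -/
theorem overOsculation_exponent_pos {β τ δ : ℝ} (h1 : 1 < τ) (hβ : τ < β) (hδ : 0 < δ) :
    0 < δ * (1 + β - τ) / (τ - 1) :=
  div_pos (mul_pos hδ (by linarith)) (by linarith)

/-- **Ledger + Bézout = Roy.** `e_Z ≥ c T D^{a}`, `a = δ(1+β−τ)/(τ−1)`, with `e_Z · deg Z ≤ D²`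
gives `deg Z ≤ D^{2−τ−a}/c`, and `2 − τ − a` IS Roy's enemy-degree exponent
`e(δ) = (2−τ) − δ − δ(2+β−2τ)/(τ−1)` of Step 5 (TRIAGE-r2-1 `ledger_bezout_is_roy`, r2-2
`ledger_bezout_returns_roy`): on a sole server the ledger moves no exponent. [folklore] -/
theorem ledger_bezout_is_roy {β τ δ : ℝ} (h1 : 1 < τ) :
    2 - τ - δ * (1 + β - τ) / (τ - 1) = (2 - τ) - δ - δ * (2 + β - 2 * τ) / (τ - 1) := by
  have hτ : τ - 1 ≠ 0 := by intro h; linarith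
  field_simp
  ring

/-- `e(δ_R) = 0`: at Roy's threshold the surviving enemy has bounded degree (why sub-gap windows near
`δ_R` fall to bounded-degree transcendence measures, and why that is invisible to the crux).
[cite: Roy2013, §7, Step 5] -/
theorem degExp_royGap {β τ : ℝ} (h1 : 1 < τ) (hβ : τ < β) :
    2 - τ - royGap β τ * (1 + β - τ) / (τ - 1) = 0 := by
  unfold royGap
  have hτ : τ - 1 ≠ 0 := by intro h; linarith
  have hb : β + 1 - τ ≠ 0 := by intro h; linarith
  field_simp
  ring

/-- **The natural arithmetic (O)-tool is Siegel-balanced.** An "osculation–height inequality"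
`log ‖P‖ ≥ c·(m/D)·h(Z)` for an integer form of degree `D` osculating the leaves at a 0-cycle `Z` to
order `m` (consistent with Gelfond's lemma at `m ≍ D`, with Hermite–Padé forms, and with the
Thue–Siegel polynomial of Disproof §5 / the §6 window witness at `m ≈ D²/4`) applied to the sole
server (`m ≥ e ≳ (D*)^{τ−1} D^{ν}/h(Z)` from ledger + Step 4, `log ‖P̃_D‖ ≤ 2D^β`) reads, with
`D* = D^x`, `x(τ−1) + ν − 1 ≤ β`; this is EQUIVALENT to Roy's own descent bound `x ≤ b(δ) = 1 − δ/(τ−1)`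
(`Roy2013.endgame_step`.1) — the height `h(Z)` cancels and no exponent moves. [folklore] -/
theorem osculationHeight_balanced {β τ δ x : ℝ} (h1 : 1 < τ) :
    x * (τ - 1) + (2 + β - τ + δ) - 1 ≤ β ↔ x ≤ 1 - δ / (τ - 1) := by
  have hτ : 0 < τ - 1 := by linarith
  rw [show (1 : ℝ) - δ / (τ - 1) = ((τ - 1) - δ) / (τ - 1) by field_simp, le_div_iff₀ hτ]
  constructor <;> intro h <;> linarith

/-- **Chains of bounded-degree servers die by Nesterenko–Waldschmidt iff `β < 2τ − 2 + δ`.** A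
server `α_{n+1}` entering at level `D'` has `h(α_{n+1}) ≲ D'^{1+β−τ}` (Step 3), the outgoing server's
leaf-closeness is `≳ D'^{β+δ}` (ledger floor), and a bilinear Hermite–Lindemann measure costs
`h(α_n)h(α_{n+1}) ≲ h(α_{n+1})²`; contradiction iff `(β+δ)/(1+β−τ) > 2`. [folklore] -/
theorem chainNW_kill_iff {β τ δ : ℝ} (hβτ : 0 < 1 + β - τ) :
    2 < (β + δ) / (1 + β - τ) ↔ β < 2 * τ - 2 + δ := by
  rw [lt_div_iff₀ hβτ]
  constructor <;> intro h <;> linarith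

/-- … which on the crux's range `τ < β` forces `τ > 2 − δ`: dead at the edge `δ → 0⁺` for every
`τ < 2` (the round-1 "edge budget" seen from the ledger; fat enemies `deg ≍ D^{2−τ}` only make it
worse through the degree dependence of the measure). [folklore] -/
theorem chainNW_dead_at_edge {β τ δ : ℝ} (hτβ : τ < β) (h : β < 2 * τ - 2 + δ) : 2 - δ < τ := by
  linarith

/-- **Window-witness exponents** (TRIAGE-r2-3 `window_exponents`, re-derived): the `∃ᶠ` witness of the
landed `roySmallValueDirichletGap_false_with_frequently` serves, around the centre `D₀` of each window,
ALL levels `[D₀^{2ν/(ν+4)}, D₀^{8/(ν+4)}]`, and `2ν/(ν+4) < 1 < 8/(ν+4)` for `0 < ν < 4`: every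
level-local or bounded-window structure (absorption, rigidity, the ledger, over-osculation
`m ≈ D²/4 ≫ 3⌊D^τ⌋` at a rational point of height `≲ D^{β−1}`) is REALISED at a transcendental point,
so no level-local cap on osculation can be both true and sufficient. [folklore] -/
theorem window_witness_exponents {ν : ℝ} (h0 : 0 < ν) (h4 : ν < 4) :
    2 * ν / (ν + 4) < 1 ∧ 1 < 8 / (ν + 4) := by
  have hp : 0 < ν + 4 := by linarith
  constructor
  · rw [div_lt_one hp]; linarith
  · rw [one_lt_div hp]; linarith

/-! ## §4 Read-back against the landed Negative lemmas this line honours -/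

/-- The constant-window reduction (landed, `Negative/GapReduction.lean`): the crux is equivalent to
its restriction to any `ν`-window above the edge — why the line never aimed at a sub-gap window. -/
theorem crux_iff_nearEdge {ε : ℝ} (hε : 0 < ε) : RoySmallValueDirichletGap ↔
    ∀ (ξ η : ℂ), η ≠ 0 → ∀ (β τ ν : ℝ), 1 ≤ τ → τ < 2 → τ < β → 2 + β - τ < ν → ν ≤ 2 + β - τ + ε →
      SmallValueHyp ξ η β τ ν → IsAlgebraic ℚ ξ ∧ IsAlgebraic ℚ η :=
  Summit.Schanuel.Schanuel.Theorems.RoySmallValueDirichletGapGap.roySmallValueDirichletGap_iff_nearEdge hε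

/-- Uniformity in `D` is load-bearing (landed, `Negative/FrequentlyFalse.lean`): the `∃ᶠ D` variant
is false at `(0, η∞)` — the germ of the window-witness principle of §3. -/
theorem frequently_variant_false :
    ¬ (∀ (ξ η : ℂ), η ≠ 0 → ∀ (β τ ν : ℝ), 1 ≤ τ → τ < 2 → τ < β → 2 + β - τ < ν →
      (∃ᶠ D : ℕ in atTop, ∃ P : MvPolynomial (Fin 2) ℤ, P ≠ 0 ∧ P.totalDegree ≤ D ∧
        (mvPolyHeight P : ℝ) ≤ Real.exp ((D : ℝ) ^ β) ∧
        ∀ i : ℕ, i < 3 * ⌊(D : ℝ) ^ τ⌋₊ →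
          ‖MvPolynomial.aeval ![ξ, η] (royD^[i] P)‖ ≤ Real.exp (-(D : ℝ) ^ ν)) →
      IsAlgebraic ℚ ξ ∧ IsAlgebraic ℚ η) :=
  Summit.Schanuel.Schanuel.Theorems.RoySmallValueDirichletGapFrequently.roySmallValueDirichletGap_false_with_frequently

/-- `η ≠ 0` is load-bearing (landed, `Negative/EtaNeZeroFalse.lean`): honoured — `adist`, `closeness`
and the cap test live on `α₀ ≠ 0`, `η ≠ 0` (`lemma_4_1`, `prop_4_5_ii`); S1 carries `η ≠ 0` verbatim.
(`1 ≤ τ` / count `> D`, `Negative/TauLtOneAndCountLeDegreeFalse.lean`, is honoured by `D ≤ T` in S1: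
`levelQ = ∑_{i ≤ D} tⁱ𝒟ⁱP̃` coprime to `P̃` needs the small range to exceed `D`.) -/
theorem etaNeZero_loadBearing :
    ¬ (∀ (ξ η : ℂ), ∀ (β τ ν : ℝ), 1 ≤ τ → τ < 2 → τ < β → 2 + β - τ < ν →
      SmallValueHyp ξ η β τ ν → IsAlgebraic ℚ ξ ∧ IsAlgebraic ℚ η) :=
  Summit.Schanuel.Schanuel.Theorems.roySmallValueDirichletGap_false_without_etaNeZero

end Summit.Schanuel.Schanuel.Cruxes.RoySmallValueDirichletGap.TotalClosenessLedger

end
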